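import Mathlib
import HarnessLib

/-!
# Unique Waring decompositions with independent forms (Jennrich), toward A_∞ of crux `OrbitRestorationQP`

Route MonotoneRestoration, crux `OrbitRestorationQP` (stmt-ValiantsHypothesis-18293), line `depth-three-rung`,
stub A_∞ `stub_sigmaPiSigmaValue` (ΣΠΣ with UNBOUNDED top fan-in, value currency).  Namespace
`Summit.ValiantsHypothesis.ValiantsHypothesis.Theorems.WaringJennrich`.

The workfile `Cruxes/OrbitRestorationQP/Lines/depth-three-rung-stubA-bounded-fanin.md` §9 names the entry
point beyond bounded fan-in: IDENTIFIABLE decompositions are EQUIVARIANT (the stabiliser of `f` permutes the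
terms of a unique decomposition), hence restorable.  This file proves the first identifiability criterion,
Jennrich's uniqueness theorem for Waring decompositions with linearly independent forms, in the form needed
by the orbit argument (sequel `…WaringJennrichOrbit.lean`):

* `lin w = Σ_x w_x X_x`, `pair w u = Σ_x w_x u_x`, the directional derivative `D u` (a `K`-derivation) and
  the closed formula `iterate_D_C_mul_lin_pow` for `(D u)^m (a ℓ_w^e)`;
* `exists_dual` — dual directions for an independent family of coefficient vectors;
* `linearIndependent_lin_pow` — powers `ℓ_{w_i}^e` (`e ≥ 1`) of independent forms are independent;
* `jennrich_mem_span` / `jennrich_proportional` — **if `Σ_{i∈ι} a_i ℓ_{w_i}^d = Σ_{j∈J} a'_j ℓ_{v_j}^d` with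
  `w` linearly independent, all `a_i ≠ 0`, `d ≥ 3` and `|J| ≤ |ι|`, then every `v_j` is a scalar multiple
  of some `w_k`**;
* `jennrich_terms` — if moreover `v` is linearly independent, the matching `j ↦ k` is injective and
  `a'_j c_j^d = a_k`: the TERMS of the two decompositions agree.

Mechanism: `(D u_k)^{d-2}` of the left side is a nonzero multiple of `ℓ_{w_k}^2`, of the right side a
combination of the `ℓ_{v_j}^2`; so `span{ℓ_{w_k}^2} ≤ span{ℓ_{v_j}^2}`, and the dimension count forces
equality; a square `ℓ_v^2` lying in `span{ℓ_{w_k}^2}` has `v ∈ span w` (test against annihilating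
directions) with at most one nonzero coordinate (test against `D u_a D u_b`, `a ≠ b`).  Everything is proved;
general field of characteristic `0`, any finite variable set. [folklore; cite: Harshman 1970 / Jennrich,
uniqueness of low-rank tensor decompositions — here only the symmetric, linearly independent case]
-/

noncomputable section

open scoped Classical

-- `Summit.ValiantsHypothesis.ValiantsHypothesis.…` is the tree's single-conjunct layout (Sub = Summit).
set_option linter.dupNamespace false

namespace Summit.ValiantsHypothesis.ValiantsHypothesis.Theorems

namespace WaringJennrich

open MvPolynomial Finset

universe u v

variable {K : Type u} [Field K] {X : Type v} [Fintype X]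

/-! ### Linear forms, pairings, directional derivatives -/

/-- The linear form with coefficient vector `w`. [folklore] -/
def lin (w : X → K) : MvPolynomial X K := ∑ x, C (w x) * MvPolynomial.X x

/-- The pairing of a coefficient vector `w` with a direction `u`. [folklore] -/
def pair (w u : X → K) : K := ∑ x, w x * u x

/-- The directional derivative along `u`, a `K`-derivation of `K[X]` (`X_x ↦ u_x`). [folklore] -/
def D (u : X → K) : Derivation K (MvPolynomial X K) (MvPolynomial X K) :=
  MvPolynomial.mkDerivation K fun x => C (u x)

omit [Fintype X] in
/-- `D u` on a variable. [folklore] -/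
theorem D_X (u : X → K) (x : X) : D u (MvPolynomial.X x) = C (u x) := by
  simp [D, mkDerivation_X]

omit [Fintype X] in
/-- `D u` kills constants. [folklore] -/
theorem D_C (u : X → K) (a : K) : D u (C a) = 0 := derivation_C _ _

omit [Fintype X] in
/-- `D u` commutes with scaling by a constant. [folklore] -/
theorem D_C_mul (u : X → K) (a : K) (p : MvPolynomial X K) : D u (C a * p) = C a * D u p := by
  rw [(D u).leibniz, D_C, smul_zero, add_zero, smul_eq_mul]

/-- `D u` of a linear form is the constant `pair w u`. [folklore] -/
theorem D_lin (u w : X → K) : D u (lin w) = C (pair w u) := by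
  simp only [lin, pair, map_sum, D_C_mul, D_X, ← map_mul]

/-- `lin` is additive. [folklore] -/
theorem lin_add (w w' : X → K) : lin (w + w') = lin w + lin w' := by
  simp only [lin, Pi.add_apply, map_add, add_mul, Finset.sum_add_distrib]

/-- `lin` commutes with scaling. [folklore] -/
theorem lin_smul (c : K) (w : X → K) : lin (c • w) = C c * lin w := by
  simp only [lin, Pi.smul_apply, smul_eq_mul, map_mul, mul_assoc, Finset.mul_sum]

/-- `lin` of a linear combination. [folklore] -/
theorem lin_sum {ι : Type*} (s : Finset ι) (c : ι → K) (w : ι → X → K) :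
    lin (∑ i ∈ s, c i • w i) = ∑ i ∈ s, C (c i) * lin (w i) := by
  induction s using Finset.induction_on with
  | empty => simp [lin]
  | insert i s hi ih => rw [Finset.sum_insert hi, Finset.sum_insert hi, lin_add, lin_smul, ih]

/-- `pair` is additive in the vector. [folklore] -/
theorem pair_add (w w' u : X → K) : pair (w + w') u = pair w u + pair w' u := by
  simp only [pair, Pi.add_apply, add_mul, Finset.sum_add_distrib]

/-- `pair` commutes with scaling of the vector. [folklore] -/
theorem pair_smul (c : K) (w u : X → K) : pair (c • w) u = c * pair w u := by
  simp only [pair, Pi.smul_apply, smul_eq_mul, mul_assoc, Finset.mul_sum]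

/-- `pair` of a linear combination. [folklore] -/
theorem pair_sum {ι : Type*} (s : Finset ι) (c : ι → K) (w : ι → X → K) (u : X → K) :
    pair (∑ i ∈ s, c i • w i) u = ∑ i ∈ s, c i * pair (w i) u := by
  induction s using Finset.induction_on with
  | empty => simp [pair]
  | insert i s hi ih => rw [Finset.sum_insert hi, Finset.sum_insert hi, pair_add, pair_smul, ih]

/-- The pairing against the direction represented by a linear functional is the functional. [folklore] -/
theorem pair_dual (φ : (X → K) →ₗ[K] K) (v : X → K) :
    pair v (fun x => φ (fun y => if x = y then 1 else 0)) = φ v := by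
  rw [LinearMap.pi_apply_eq_sum_univ φ v, pair]
  simp only [smul_eq_mul]

/-- **Iterated directional derivatives of a scaled power of a linear form**:
`(D u)^m (a ℓ^e) = a · e(e-1)⋯(e-m+1) · ⟨w,u⟩^m · ℓ^(e-m)`. [folklore] -/
theorem iterate_D_C_mul_lin_pow (u w : X → K) (a : K) (e : ℕ) :
    ∀ m : ℕ, (D u)^[m] (C a * lin w ^ e) =
      C (a * (e.descFactorial m : K) * pair w u ^ m) * lin w ^ (e - m)
  | 0 => by simp
  | m + 1 => by
      rw [Function.iterate_succ_apply', iterate_D_C_mul_lin_pow u w a e m, D_C_mul,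
        (D u).leibniz_pow, D_lin, Nat.descFactorial_succ, smul_eq_mul, nsmul_eq_mul]
      have h : e - (m + 1) = e - m - 1 := by omega
      rw [h]
      simp only [Nat.cast_mul, map_mul, map_natCast, pow_succ, map_pow]
      ring

omit [Fintype X] in
/-- The iterate of `D u` as a power of the underlying linear map. [folklore] -/
theorem iterate_D_eq_pow (u : X → K) (m : ℕ) (p : MvPolynomial X K) :
    (D u)^[m] p = ((D u : MvPolynomial X K →ₗ[K] MvPolynomial X K) ^ m) p := by
  rw [Module.End.pow_apply, Derivation.coeFn_coe]

/-- **Iterated directional derivative of a Waring expression.** [folklore] -/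
theorem iterate_D_sum {ι : Type*} [Fintype ι] (u : X → K) (a : ι → K) (v : ι → X → K) (d m : ℕ) :
    (D u)^[m] (∑ i, C (a i) * lin (v i) ^ d) =
      ∑ i, C (a i * (d.descFactorial m : K) * pair (v i) u ^ m) * lin (v i) ^ (d - m) := by
  rw [iterate_D_eq_pow, map_sum]
  exact Finset.sum_congr rfl fun i _ => by rw [← iterate_D_eq_pow, iterate_D_C_mul_lin_pow]

/-! ### Dual directions and independence of powers -/

/-- **Dual directions**: a linearly independent family of coefficient vectors has directions `u_i` with
`⟨w_k, u_i⟩ = δ_{ki}`. [folklore] -/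
theorem exists_dual {ι : Type*} (w : ι → X → K) (hw : LinearIndependent K w) :
    ∃ u : ι → X → K, ∀ i k, pair (w k) (u i) = if k = i then 1 else 0 := by
  obtain ⟨g, hg⟩ := LinearMap.exists_leftInverse_of_injective
    (Submodule.span K (Set.range w)).subtype (Submodule.ker_subtype _)
  let b := Module.Basis.span hw
  refine ⟨fun i x => ((b.coord i).comp g) (fun y => if x = y then 1 else 0), fun i k => ?_⟩
  rw [pair_dual]
  have hk : w k = (Submodule.span K (Set.range w)).subtype (b k) := by
    rw [Submodule.subtype_apply, Module.Basis.span_apply]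
  have hgk : g ((Submodule.span K (Set.range w)).subtype (b k)) = b k := by
    rw [← LinearMap.comp_apply, hg, LinearMap.id_apply]
  rw [LinearMap.comp_apply, hk, hgk, Module.Basis.coord_apply, Module.Basis.repr_self, Finsupp.single_apply]

variable [CharZero K]

/-- **Powers of independent linear forms are independent** (`e ≥ 1`). [folklore] -/
theorem linearIndependent_lin_pow {ι : Type*} [Fintype ι] (w : ι → X → K) (hw : LinearIndependent K w)
    {e : ℕ} (he : 1 ≤ e) : LinearIndependent K fun i => lin (w i) ^ e := by
  obtain ⟨u, hu⟩ := exists_dual w hw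
  rw [Fintype.linearIndependent_iff]
  intro g hg i
  have hg' : ∑ k, C (g k) * lin (w k) ^ e = 0 := by
    rw [← hg]; exact Finset.sum_congr rfl fun k _ => (smul_eq_C_mul _ _).symm
  have h := congrArg ((D (u i))^[e]) hg'
  rw [iterate_D_sum, iterate_D_eq_pow, map_zero] at h
  rw [Finset.sum_eq_single i (fun k _ hk => by rw [hu i k, if_neg hk, zero_pow (by omega)]; simp)
    (fun h => (h (Finset.mem_univ i)).elim), hu i i, if_pos rfl, one_pow, mul_one, Nat.sub_self, pow_zero,
    mul_one, Nat.descFactorial_self, C_eq_zero, mul_eq_zero] at h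
  rcases h with h | h
  · exact h
  · exact absurd h (by exact_mod_cast e.factorial_ne_zero)

/-! ### Jennrich's uniqueness theorem -/

section Core

variable {ι J : Type*} [Fintype ι] [Fintype J] (w : ι → X → K) (a : ι → K) (v : J → X → K) (a' : J → K)
  {d : ℕ}

/-- The key containment: every square `ℓ_{v_j}^2` of the second decomposition lies in the span of the
squares `ℓ_{w_k}^2` of the independent one. [folklore] -/
theorem jennrich_sq_mem_span (hw : LinearIndependent K w) (ha : ∀ i, a i ≠ 0) (hd : 3 ≤ d)
    (hcard : Fintype.card J ≤ Fintype.card ι)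
    (h : ∑ i, C (a i) * lin (w i) ^ d = ∑ j, C (a' j) * lin (v j) ^ d) (j : J) :
    lin (v j) ^ 2 ∈ Submodule.span K (Set.range fun k => lin (w k) ^ 2) := by
  obtain ⟨u, hu⟩ := exists_dual w hw
  set Q := Submodule.span K (Set.range fun k => lin (w k) ^ 2) with hQ
  set Q' := Submodule.span K (Set.range fun j => lin (v j) ^ 2) with hQ'
  -- `Q ≤ Q'`: `ℓ_{w_k}^2` is a nonzero multiple of `(D u_k)^{d-2} f ∈ Q'`.
  have hle : Q ≤ Q' := by
    rw [hQ, Submodule.span_le]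
    rintro _ ⟨k, rfl⟩
    have hk := congrArg ((D (u k))^[d - 2]) h
    rw [iterate_D_sum, iterate_D_sum, Finset.sum_eq_single k
      (fun i _ hi => by rw [hu k i, if_neg hi, zero_pow (by omega)]; simp)
      (fun h => (h (Finset.mem_univ k)).elim), hu k k, if_pos rfl, one_pow, mul_one] at hk
    have hd2 : d - (d - 2) = 2 := by omega
    rw [hd2] at hk
    have hne : a k * (d.descFactorial (d - 2) : K) ≠ 0 := by
      refine mul_ne_zero (ha k) ?_
      have : d.descFactorial (d - 2) ≠ 0 := by
        rw [Ne, Nat.descFactorial_eq_zero_iff_lt]; omega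
      exact_mod_cast this
    have hrepr : lin (w k) ^ 2 = (a k * (d.descFactorial (d - 2) : K))⁻¹ •
        ∑ j, C (a' j * (d.descFactorial (d - 2) : K) * pair (v j) (u k) ^ (d - 2)) * lin (v j) ^ 2 := by
      rw [← hk, smul_eq_C_mul, ← mul_assoc, ← map_mul, inv_mul_cancel₀ hne, map_one, one_mul]
    show lin (w k) ^ 2 ∈ Q'
    rw [hrepr]
    refine Submodule.smul_mem _ _ (Submodule.sum_mem _ fun j _ => ?_)
    rw [← smul_eq_C_mul]
    exact Submodule.smul_mem _ _ (Submodule.subset_span ⟨j, rfl⟩)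
  -- dimension count
  haveI : FiniteDimensional K Q' := FiniteDimensional.span_of_finite K (Set.finite_range _)
  have hfin : Module.finrank K Q = Fintype.card ι :=
    finrank_span_eq_card (linearIndependent_lin_pow w hw (e := 2) (by norm_num))
  have hfin' : Module.finrank K Q' ≤ Fintype.card J := finrank_range_le_card _
  have hQQ' : Q = Q' := Submodule.eq_of_le_of_finrank_le hle (by omega)
  rw [hQQ']
  exact Submodule.subset_span ⟨j, rfl⟩

omit [CharZero K] in
/-- Second directional derivatives of a scaled square of a linear form. [folklore] -/
theorem D_D_C_mul_sq (β : K) (z u u' : X → K) :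
    D u (D u' (C β * lin z ^ 2)) = C (2 * β * pair z u' * pair z u) := by
  have h1 := iterate_D_C_mul_lin_pow u' z β 2 1
  have h2 := iterate_D_C_mul_lin_pow u z (β * ((2 : ℕ).descFactorial 1 : K) * pair z u' ^ 1) 1 1
  simp only [Function.iterate_one] at h1 h2
  rw [h1, h2]
  simp only [Nat.descFactorial_one, Nat.cast_ofNat, Nat.cast_one, pow_one, mul_one, Nat.sub_self, pow_zero]
  congr 1
  ring

omit [CharZero K] in
/-- Second directional derivatives of a combination of squares of linear forms. [folklore] -/
theorem D_D_sum_sq {κ : Type*} (s : Finset κ) (β : κ → K) (z : κ → X → K) (u u' : X → K) :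
    D u (D u' (∑ k ∈ s, C (β k) * lin (z k) ^ 2)) = C (∑ k ∈ s, 2 * β k * pair (z k) u' * pair (z k) u) := by
  rw [map_sum, map_sum, map_sum]
  exact Finset.sum_congr rfl fun k _ => D_D_C_mul_sq (β k) (z k) u u'

omit [CharZero K] in
/-- Testing an expansion `ℓ_v^2 = Σ_k β_k ℓ_{w_k}^2` against two directions. [folklore] -/
theorem test_sq_expansion {κ : Type*} [Fintype κ] {β : κ → K} {z : κ → X → K} {y : X → K}
    (hβ : ∑ k, β k • lin (z k) ^ 2 = lin y ^ 2) (u u' : X → K) :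
    ∑ k, 2 * β k * pair (z k) u' * pair (z k) u = 2 * pair y u' * pair y u := by
  have hβ' : ∑ k, C (β k) * lin (z k) ^ 2 = C 1 * lin y ^ 2 := by
    rw [map_one, one_mul, ← hβ]; exact Finset.sum_congr rfl fun k _ => (smul_eq_C_mul _ _).symm
  have key := congrArg (fun p => D u (D u' p)) hβ'
  simp only [D_D_sum_sq, D_D_C_mul_sq, C_inj, mul_one] at key
  exact key

/-- **Jennrich, step 1**: every `v_j` lies in the span of the `w_k`. [folklore] -/
theorem jennrich_mem_span (hw : LinearIndependent K w) (ha : ∀ i, a i ≠ 0) (hd : 3 ≤ d)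
    (hcard : Fintype.card J ≤ Fintype.card ι)
    (h : ∑ i, C (a i) * lin (w i) ^ d = ∑ j, C (a' j) * lin (v j) ^ d) (j : J) :
    v j ∈ Submodule.span K (Set.range w) := by
  have hmem := jennrich_sq_mem_span w a v a' hw ha hd hcard h j
  obtain ⟨β, hβ⟩ := (Submodule.mem_span_range_iff_exists_fun K).mp hmem
  by_contra hj
  obtain ⟨ψ, hψ, hψ0⟩ := Submodule.exists_dual_map_eq_bot_of_notMem hj inferInstance
  set u : X → K := fun x => ψ (fun y => if x = y then 1 else 0) with hu
  have hker : Submodule.span K (Set.range w) ≤ LinearMap.ker ψ := LinearMap.le_ker_iff_map.mpr hψ0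
  have hwk : ∀ k, pair (w k) u = 0 := by
    intro k
    rw [hu, pair_dual]
    exact LinearMap.mem_ker.mp (hker (Submodule.subset_span ⟨k, rfl⟩))
  have key := test_sq_expansion hβ u u
  simp only [hwk, mul_zero, Finset.sum_const_zero] at key
  rw [hu, pair_dual] at key
  have h2 : ψ (v j) * ψ (v j) = 0 := by
    have h2' : (2 : K) * (ψ (v j) * ψ (v j)) = 0 := by rw [← mul_assoc]; exact key.symm
    exact (mul_eq_zero.mp h2').resolve_left two_ne_zero
  exact hψ (mul_self_eq_zero.mp h2)

/-- **Jennrich, step 2 (uniqueness of Waring decompositions with independent forms)**: if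
`Σ_i a_i ℓ_{w_i}^d = Σ_j a'_j ℓ_{v_j}^d` with `w` linearly independent, all `a_i ≠ 0`, `d ≥ 3` and
`|J| ≤ |ι|`, then every `v_j` is proportional to a single `w_k`. [folklore] -/
theorem jennrich_proportional (hw : LinearIndependent K w) (ha : ∀ i, a i ≠ 0) (hd : 3 ≤ d)
    (hcard : Fintype.card J ≤ Fintype.card ι)
    (h : ∑ i, C (a i) * lin (w i) ^ d = ∑ j, C (a' j) * lin (v j) ^ d) (j : J) :
    ∃ (k : ι) (c : K), v j = c • w k := by
  obtain ⟨u, hu⟩ := exists_dual w hw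
  have hmem := jennrich_sq_mem_span w a v a' hw ha hd hcard h j
  obtain ⟨β, hβ⟩ := (Submodule.mem_span_range_iff_exists_fun K).mp hmem
  obtain ⟨c, hc⟩ := (Submodule.mem_span_range_iff_exists_fun K).mp
    (jennrich_mem_span w a v a' hw ha hd hcard h j)
  -- coordinates: `pair (v j) (u i) = c i`
  have hcoord : ∀ i, pair (v j) (u i) = c i := by
    intro i
    rw [← hc, pair_sum]
    simp only [hu i, mul_ite, mul_one, mul_zero, Finset.sum_ite_eq', Finset.mem_univ, if_true]
  -- distinct coordinates have vanishing product
  have hprod : ∀ i i', i ≠ i' → c i * c i' = 0 := by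
    intro i i' hii'
    have key := test_sq_expansion hβ (u i) (u i')
    rw [hcoord, hcoord, Finset.sum_eq_zero] at key
    · have h2 : (2 : K) * (c i' * c i) = 0 := by rw [← mul_assoc]; exact key.symm
      rw [mul_comm (c i)]
      exact (mul_eq_zero.mp h2).resolve_left two_ne_zero
    · intro k _
      rw [hu i' k, hu i k]
      by_cases hk : k = i'
      · subst hk; rw [if_neg (Ne.symm hii')]; ring
      · rw [if_neg hk]; ring
  by_cases hex : ∃ i, c i ≠ 0
  · obtain ⟨i, hi⟩ := hex
    refine ⟨i, c i, ?_⟩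
    rw [← hc, Finset.sum_eq_single i (fun k _ hk => ?_) (fun h => (h (Finset.mem_univ i)).elim)]
    have := hprod i k (Ne.symm hk)
    rw [(mul_eq_zero.mp this).resolve_left hi, zero_smul]
  · push Not at hex
    have hι : Nonempty ι := by
      have : 0 < Fintype.card J := Fintype.card_pos_iff.mpr ⟨j⟩
      exact Fintype.card_pos_iff.mp (by omega)
    obtain ⟨k⟩ := hι
    refine ⟨k, 0, ?_⟩
    rw [zero_smul, ← hc]
    exact Finset.sum_eq_zero fun i _ => by rw [hex i, zero_smul]

omit [CharZero K] in
/-- Top directional derivative of a Waring expression. [folklore] -/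
theorem iterate_D_top {κ : Type*} [Fintype κ] (u : X → K) (a : κ → K) (v : κ → X → K) (d : ℕ) :
    (D u)^[d] (∑ i, C (a i) * lin (v i) ^ d) = C (∑ i, a i * (d.factorial : K) * pair (v i) u ^ d) := by
  rw [iterate_D_sum, map_sum]
  refine Finset.sum_congr rfl fun i _ => ?_
  rw [Nat.sub_self, pow_zero, mul_one, Nat.descFactorial_self]

/-- **Jennrich, step 3 (the terms agree)**: if moreover `v` is linearly independent, then the matching
`j ↦ k` is injective and the coefficients satisfy `a'_j c_j^d = a_k` — the two decompositions have the same
terms. [folklore] -/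
theorem jennrich_terms (hw : LinearIndependent K w) (ha : ∀ i, a i ≠ 0) (hd : 3 ≤ d)
    (hcard : Fintype.card J ≤ Fintype.card ι) (hv : LinearIndependent K v)
    (h : ∑ i, C (a i) * lin (w i) ^ d = ∑ j, C (a' j) * lin (v j) ^ d) :
    ∃ (k : J → ι) (c : J → K), Function.Injective k ∧ (∀ j, v j = c j • w (k j)) ∧
      ∀ j, a' j * c j ^ d = a (k j) := by
  choose k c hkc using jennrich_proportional w a v a' hw ha hd hcard h
  have hc0 : ∀ j, c j ≠ 0 := by
    intro j hj
    have := hv.ne_zero j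
    rw [hkc j, hj, zero_smul] at this
    exact this rfl
  have hinj : Function.Injective k := by
    intro j j' hjj'
    by_contra hne
    -- `c j' • v j - c j • v j' = 0` is a nontrivial relation among the `v`
    let g : J → K := fun i => (if i = j then c j' else 0) - (if i = j' then c j else 0)
    have hsum : ∑ i, g i • v i = 0 := by
      have h1 : ∑ i, g i • v i = c j' • v j - c j • v j' := by
        simp only [g, sub_smul, ite_smul, zero_smul, Finset.sum_sub_distrib, Finset.sum_ite_eq',
          Finset.mem_univ, if_true]
      rw [h1, hkc j, hkc j', hjj', smul_smul, smul_smul, mul_comm, sub_self]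
    have hgj : g j = 0 := Fintype.linearIndependent_iff.mp hv g hsum j
    have : g j = c j' := by simp [g, hne]
    exact hc0 j' (this ▸ hgj)
  obtain ⟨u, hu⟩ := exists_dual w hw
  refine ⟨k, c, hinj, hkc, fun j => ?_⟩
  -- apply `(D u_{k j})^d` to both sides
  have hk := congrArg ((D (u (k j)))^[d]) h
  rw [iterate_D_top, iterate_D_top, C_inj] at hk
  have hL : ∑ i, a i * (d.factorial : K) * pair (w i) (u (k j)) ^ d = a (k j) * d.factorial := by
    rw [Finset.sum_eq_single (k j)]
    · rw [hu, if_pos rfl, one_pow, mul_one]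
    · intro i _ hi
      rw [hu (k j) i, if_neg hi, zero_pow (by omega), mul_zero]
    · intro h'; exact (h' (Finset.mem_univ _)).elim
  have hR : ∑ j', a' j' * (d.factorial : K) * pair (v j') (u (k j)) ^ d =
      a' j * c j ^ d * d.factorial := by
    rw [Finset.sum_eq_single j]
    · rw [hkc j, pair_smul, hu, if_pos rfl, mul_one]; ring
    · intro j' _ hj'
      rw [hkc j', pair_smul, hu (k j) (k j'), if_neg (fun h' => hj' (hinj h')), mul_zero,
        zero_pow (by omega), mul_zero]
    · intro h'; exact (h' (Finset.mem_univ _)).elim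
  rw [hL, hR] at hk
  have hfact : (d.factorial : K) ≠ 0 := by exact_mod_cast d.factorial_ne_zero
  exact (mul_right_cancel₀ hfact hk).symm

end Core

end WaringJennrich

end Summit.ValiantsHypothesis.ValiantsHypothesis.Theorems

end
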